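import Literature.Analysis.Distribution.FourierLaplaceTransform
import HarnessLib

/-!
# The Fourier–Laplace transform is holomorphic and polynomially bounded in the tube

Topic `Literature/Analysis/Distribution`. Fourth brick of the proof of
`fourierLaplace_coneSupport` (`FourierLaplaceCone`). For a continuous linear functional `T` on
`𝓢(ℝ^ι, ℂ)` and a set `S ⊆ ℝ^ι`, the function `F = fourierLaplaceFun T S`,
`F(z) = u(χ_S e^{−2πi⟨z,·⟩})`, `u = T ∘ 𝓕⁻¹` (`FourierLaplaceTransform`), satisfies:

* `exists_bound_seminorm_clm`: a tempered distribution is bounded by finitely many Schwartz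
  seminorms (Streater–Wightman (1964), §2-1; `Seminorm.bound_of_continuous`);
* `exists_norm_fourierLaplaceFun_le` — **Streater–Wightman Thm. 2-6, estimate (2-65) /
  Hörmander Thm. 7.4.2, "`|û(ζ)| ≤ C(1 + |ζ|)^N`, `Im ζ ∈ M`"**: on `{Im z ∈ M}`, `M` a compact
  subset of the open cone `interior S⁻`, `|F(z)| ≤ C (1 + ‖z‖)^N` (the seminorms of the kernel
  grow polynomially, `exists_seminorm_laplaceKernel_le`);
* `hasFDerivAt_fourierLaplaceFun`, `differentiableOn_fourierLaplaceFun` — **Streater–Wightman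
  Thm. 2-6, first assertion / Hörmander Thm. 7.4.2: `F` is holomorphic in the tube
  `{Im z ∈ interior S⁻}`**. Printed proof (S–W pdf p. 52): "`∂/∂ξⱼ ℒ(T) = ℱ(−ipⱼ e^{−p·η}T) =
  i ∂/∂ηⱼ ℒ(T)`, which are the Cauchy–Riemann equations". Here directly: the complex difference
  quotient of the kernel converges in every Schwartz seminorm — the remainder
  `χ e^{ℓ_z}(e^{ℓ_w} − 1 − ℓ_w)` has seminorms `O(‖w‖²)`
  (`norm_iteratedFDeriv_cutoff_cexp_remainder_le`) — and `u` is bounded by finitely many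
  seminorms; the derivative is `w ↦ ∑ᵢ wᵢ u(−2πiξᵢ χ e^{ℓ_z})`.

## References

* R. F. Streater, A. S. Wightman, *PCT, Spin and Statistics, and All That*, §2-3, Thm. 2-6 and
  its proof (pdf pp. 49–52 of the 2000 printing). [StreaterWightman1964]
* L. Hörmander, *The Analysis of Linear Partial Differential Operators I*, 2nd ed., Thm. 7.4.2.
  [HormanderALPDO1]
-/

noncomputable section

open Set Filter Metric SchwartzMap Asymptotics
open _root_.Complex (exp I)
open scoped ContDiff Topology RealInnerProductSpace SchwartzMap FourierTransform NNReal

namespace Literature.Analysis.Distribution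

/-! ### Tempered distributions are bounded by finitely many seminorms -/

/-- **A continuous linear functional on Schwartz space is bounded by finitely many seminorms**:
`‖u ψ‖ ≤ C sup_{(k,n) ≤ (k₀,n₀)} ‖ψ‖_{k,n}` (Streater–Wightman (1964), §2-1).
[cite: StreaterWightman1964, §2-1] -/
theorem exists_bound_seminorm_clm {V : Type*} [NormedAddCommGroup V] [NormedSpace ℝ V]
    (u : 𝓢(V, ℂ) →L[ℂ] ℂ) :
    ∃ (k₀ n₀ : ℕ) (C : ℝ), 0 ≤ C ∧ ∀ ψ,
      ‖u ψ‖ ≤ C * (Finset.Iic (k₀, n₀)).sup (schwartzSeminormFamily ℂ V ℂ) ψ := by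
  set q : Seminorm ℂ 𝓢(V, ℂ) := (normSeminorm ℂ ℂ).comp u.toLinearMap
  have hq : Continuous q := continuous_norm.comp u.continuous
  obtain ⟨s, C, _, hle⟩ := Seminorm.bound_of_continuous (schwartz_withSeminorms ℂ V ℂ) q hq
  refine ⟨s.sup Prod.fst, s.sup Prod.snd, C, NNReal.coe_nonneg C, fun ψ => ?_⟩
  have h1 : ‖u ψ‖ = q ψ := rfl
  rw [h1]
  refine (hle ψ).trans ?_
  change C • (s.sup (schwartzSeminormFamily ℂ V ℂ)) ψ ≤ _
  rw [NNReal.smul_def, smul_eq_mul]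
  gcongr
  have hsub : s ⊆ Finset.Iic (s.sup Prod.fst, s.sup Prod.snd) := fun m hm =>
    Finset.mem_Iic.2 ⟨Finset.le_sup (f := Prod.fst) hm, Finset.le_sup (f := Prod.snd) hm⟩
  exact Seminorm.le_def.1 (Finset.sup_mono hsub) ψ

variable {ι : Type*} [Fintype ι]

/-! ### Polynomial bound -/

/-- **Polynomial bound of the Fourier–Laplace transform on `{Im z ∈ M}`** for a compact subset
`M` of the open cone (Streater–Wightman (1964), Thm. 2-6, (2-65); Hörmander (1990), Thm. 7.4.2:
"for every compact set `M ⊂ Γ°` there is an estimate `|û(ζ)| ≤ C(1+|ζ|)^N`, `Im ζ ∈ M`").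
[cite: StreaterWightman1964, Thm 2-6 eq (2-65)] -/
theorem exists_norm_fourierLaplaceFun_le (T : 𝓢(EuclideanSpace ℝ ι, ℂ) →L[ℂ] ℂ)
    (S : Set (EuclideanSpace ℝ ι)) {M : Set (EuclideanSpace ℝ ι)} (hM : IsCompact M)
    (hMS : M ⊆ interior (polarCone S)) :
    ∃ (C : ℝ) (N : ℕ), ∀ z : ι → ℂ, imVec z ∈ M → ‖fourierLaplaceFun T S z‖ ≤ C * (1 + ‖z‖) ^ N := by
  obtain ⟨k₀, n₀, Cu, hCu, hu⟩ := exists_bound_seminorm_clm (fourierInvDual T)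
  choose D hD0 hD using fun m : ℕ × ℕ => exists_seminorm_laplaceKernel_le S hM hMS m.1 m.2
  refine ⟨Cu * ∑ m ∈ Finset.Iic (k₀, n₀), D m, n₀, fun z hz => ?_⟩
  rw [fourierLaplaceFun_apply]
  refine (hu _).trans ?_
  rw [mul_assoc]
  refine mul_le_mul_of_nonneg_left ?_ hCu
  refine Seminorm.finset_sup_apply_le
    (mul_nonneg (Finset.sum_nonneg fun m _ => hD0 m) (by positivity)) fun m hm => ?_
  rw [schwartzSeminormFamily_apply]
  have hm2 : m.2 ≤ n₀ := (Finset.mem_Iic.1 hm).2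
  have h1z : (1 : ℝ) ≤ 1 + ‖z‖ := by linarith [norm_nonneg z]
  calc SchwartzMap.seminorm ℂ m.1 m.2 (laplaceKernel S z) ≤ D m * (1 + ‖z‖) ^ m.2 := hD m z hz
    _ ≤ D m * (1 + ‖z‖) ^ n₀ := mul_le_mul_of_nonneg_left (pow_le_pow_right₀ h1z hm2) (hD0 m)
    _ ≤ (∑ m' ∈ Finset.Iic (k₀, n₀), D m') * (1 + ‖z‖) ^ n₀ := by
        gcongr
        exact Finset.single_le_sum (fun m' _ => hD0 m') hm

/-! ### Holomorphy -/

/-- The exponent form as a linear combination of the coordinate multipliers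
`ξ ↦ −2πi ξᵢ`. [folklore] -/
theorem expForm_apply_eq_sum (w : ι → ℂ) (ξ : EuclideanSpace ℝ ι) :
    expForm w ξ = ∑ i, w i * (-(2 * Real.pi * I) * (ξ i : ℂ)) := by
  rw [expForm_apply, Finset.mul_sum]
  exact Finset.sum_congr rfl fun i _ => by ring

/-- The coordinate multiplier `ξ ↦ −2πi ξᵢ` has temperate growth (it is `ℝ`-linear). [folklore] -/
theorem hasTemperateGrowth_coordMul (i : ι) :
    Function.HasTemperateGrowth fun ξ : EuclideanSpace ℝ ι => -(2 * Real.pi * I) * (ξ i : ℂ) := by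
  have h : (fun ξ : EuclideanSpace ℝ ι => -(2 * Real.pi * I) * (ξ i : ℂ)) =
      ⇑((-(2 * Real.pi * I)) • (Complex.ofRealCLM.comp (EuclideanSpace.proj (𝕜 := ℝ) i))) := by
    funext ξ
    simp
  rw [h]
  exact ContinuousLinearMap.hasTemperateGrowth _

/-- **The Fourier–Laplace transform is complex differentiable in the tube** (Streater–Wightman
(1964), Thm. 2-6; Hörmander (1990), Thm. 7.4.2), with derivative
`w ↦ ∑ᵢ wᵢ u(−2πiξᵢ χ_S e^{−2πi⟨z,·⟩})`. [cite: StreaterWightman1964, Thm 2-6] -/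
theorem hasFDerivAt_fourierLaplaceFun (T : 𝓢(EuclideanSpace ℝ ι, ℂ) →L[ℂ] ℂ)
    (S : Set (EuclideanSpace ℝ ι)) {z : ι → ℂ} (hz : imVec z ∈ interior (polarCone S)) :
    HasFDerivAt (fourierLaplaceFun T S)
      (∑ i, fourierInvDual T (SchwartzMap.smulLeftCLM ℂ
          (fun ξ : EuclideanSpace ℝ ι => -(2 * Real.pi * I) * (ξ i : ℂ)) (laplaceKernel S z)) •
        (ContinuousLinearMap.proj i : (ι → ℂ) →L[ℂ] ℂ)) z := by
  -- Step 0: `u` is bounded by finitely many seminorms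
  obtain ⟨k₀, n₀, Cu, hCu, hu⟩ := exists_bound_seminorm_clm (fourierInvDual T)
  -- Step 1: a compact ball of imaginary parts inside the open cone
  obtain ⟨ρ, hρ, hball⟩ := nhds_basis_closedBall.mem_iff.1 (isOpen_interior.mem_nhds hz)
  set M : Set (EuclideanSpace ℝ ι) := closedBall (imVec z) ρ with hM
  have hMc : IsCompact M := isCompact_closedBall _ _
  have hzM : imVec z ∈ M := mem_closedBall_self hρ.le
  -- Step 2: the exponent decays on the support of the cutoff, uniformly on `M`
  obtain ⟨c, A, hc, hre⟩ := exists_re_expForm_le S hMc hball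
  -- Step 3: smallness of `w`
  set κ : ℝ := 2 * Real.pi * Fintype.card ι with hκ
  have hκ0 : 0 ≤ κ := by positivity
  have hκw : ∀ w : ι → ℂ, ‖expForm w‖ ≤ κ * ‖w‖ := norm_expForm_le
  set ρ' : ℝ := min (ρ / (Real.sqrt (Fintype.card ι) + 1)) (min 1 (c / 2) / (κ + 1)) with hρ'
  have hρ'0 : 0 < ρ' := by positivity
  have hmemM : ∀ w : ι → ℂ, ‖w‖ ≤ ρ' → imVec (z + w) ∈ M := by
    intro w hw
    rw [hM, mem_closedBall, imVec_add, dist_eq_norm, add_sub_cancel_left]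
    have h1 := norm_imVec_le w
    have h2 : ‖w‖ ≤ ρ / (Real.sqrt (Fintype.card ι) + 1) := hw.trans (min_le_left _ _)
    rw [le_div_iff₀ (by positivity)] at h2
    nlinarith [Real.sqrt_nonneg (Fintype.card ι : ℝ), norm_nonneg w]
  have hℓw : ∀ w : ι → ℂ, ‖w‖ ≤ ρ' → ‖expForm w‖ ≤ 1 ∧ ‖expForm w‖ ≤ c / 2 := by
    intro w hw
    have h2 : ‖w‖ ≤ min 1 (c / 2) / (κ + 1) := hw.trans (min_le_right _ _)
    rw [le_div_iff₀ (by positivity)] at h2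
    have h3 : ‖expForm w‖ ≤ min 1 (c / 2) := by nlinarith [hκw w, norm_nonneg w]
    exact ⟨h3.trans (min_le_left _ _), h3.trans (min_le_right _ _)⟩
  -- the tangent Schwartz functions and the candidate derivative
  set Ψ : ι → 𝓢(EuclideanSpace ℝ ι, ℂ) := fun i => SchwartzMap.smulLeftCLM ℂ
    (fun ξ : EuclideanSpace ℝ ι => -(2 * Real.pi * I) * (ξ i : ℂ)) (laplaceKernel S z) with hΨ
  have hΨ_apply : ∀ i ξ, Ψ i ξ = -(2 * Real.pi * I) * (ξ i : ℂ) * laplaceKernel S z ξ := by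
    intro i ξ
    rw [hΨ]
    exact SchwartzMap.smulLeftCLM_apply_apply (hasTemperateGrowth_coordMul i) _ ξ
  set L : (ι → ℂ) →L[ℂ] ℂ :=
    ∑ i, fourierInvDual T (Ψ i) • (ContinuousLinearMap.proj i : (ι → ℂ) →L[ℂ] ℂ) with hL
  have hL_apply : ∀ w : ι → ℂ, L w = fourierInvDual T (∑ i, w i • Ψ i) := by
    intro w
    simp only [hL, FunLike.coe_sum, Finset.sum_apply, FunLike.coe_smul,
      Pi.smul_apply, ContinuousLinearMap.proj_apply, smul_eq_mul, map_sum, map_smul]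
    exact Finset.sum_congr rfl fun i _ => mul_comm _ _
  -- Step 4: the remainder and its pointwise form
  have hrem : ∀ w : ι → ℂ, ‖w‖ ≤ ρ' → ∀ ξ,
      (laplaceKernel S (z + w) - laplaceKernel S z - ∑ i, w i • Ψ i) ξ =
        (coneCutoff S ξ : ℂ) * exp (expForm z ξ) * (exp (expForm w ξ) - 1 - expForm w ξ) := by
    intro w hw ξ
    have hzw : imVec (z + w) ∈ interior (polarCone S) := hball (hmemM w hw)
    simp only [sub_apply, sum_apply, smul_apply, smul_eq_mul,
      hΨ_apply, laplaceKernel_apply hzw, laplaceKernel_apply hz, expForm_add,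
      add_apply, Complex.exp_add, expForm_apply_eq_sum w ξ]
    have e : ∀ i, w i * (-(2 * Real.pi * I) * (ξ i : ℂ) * ((coneCutoff S ξ : ℂ) * exp (expForm z ξ)))
        = w i * (-(2 * Real.pi * I) * (ξ i : ℂ)) * ((coneCutoff S ξ : ℂ) * exp (expForm z ξ)) :=
      fun i => by ring
    simp only [e, ← Finset.sum_mul]
    ring
  -- Step 5: seminorm bound of the remainder, `O(‖w‖²)`
  set K : ℕ × ℕ → ℝ := fun m => 4 ^ m.2 * coneCutoffBound S m.2 * (1 + ‖expForm z‖) ^ m.2 *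
    Real.exp A * κ ^ 2 * ((m.1 + 2).factorial / (c / 2) ^ (m.1 + 2) * Real.exp (c / 2)) with hK
  have hK0 : ∀ m, 0 ≤ K m := fun m => by
    have := coneCutoffBound_nonneg S m.2
    positivity
  have hsemi : ∀ w : ι → ℂ, ‖w‖ ≤ ρ' → ∀ m : ℕ × ℕ,
      SchwartzMap.seminorm ℂ m.1 m.2 (laplaceKernel S (z + w) - laplaceKernel S z - ∑ i, w i • Ψ i)
        ≤ K m * ‖w‖ ^ 2 := by
    intro w hw m
    set R := laplaceKernel S (z + w) - laplaceKernel S z - ∑ i, w i • Ψ i with hR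
    have hfun : ⇑R = fun ξ => (coneCutoff S ξ : ℂ) * exp (expForm z ξ) *
        (exp (expForm w ξ) - 1 - expForm w ξ) := funext (hrem w hw)
    have hC0 : 0 ≤ 4 ^ m.2 * coneCutoffBound S m.2 * (1 + ‖expForm z‖) ^ m.2 * Real.exp A *
        ‖expForm w‖ ^ 2 := by
      have := coneCutoffBound_nonneg S m.2
      positivity
    have hb : ∀ ξ, ‖iteratedFDeriv ℝ m.2 R ξ‖ ≤ 4 ^ m.2 * coneCutoffBound S m.2 *
        (1 + ‖expForm z‖) ^ m.2 * Real.exp A * ‖expForm w‖ ^ 2 * (1 + ‖ξ‖) ^ 2 *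
          Real.exp (-(c / 2 * ‖ξ‖)) := fun ξ => by
      rw [hfun]
      exact norm_iteratedFDeriv_cutoff_cexp_remainder_le (contDiff_coneCutoff S)
        (fun i hi x => norm_iteratedFDeriv_coneCutoff_le S hi x) (expForm z) (hre z hzM)
        (expForm w) (hℓw w hw).1 (hℓw w hw).2 ξ
    refine (seminorm_le_of_exp_bound R (half_pos hc) hC0 hb m.1).trans ?_
    have hw2 : ‖expForm w‖ ^ 2 ≤ κ ^ 2 * ‖w‖ ^ 2 := by
      rw [← mul_pow]
      exact pow_le_pow_left₀ (norm_nonneg _) (hκw w) 2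
    have hCn := coneCutoffBound_nonneg S m.2
    calc 4 ^ m.2 * coneCutoffBound S m.2 * (1 + ‖expForm z‖) ^ m.2 * Real.exp A * ‖expForm w‖ ^ 2 *
          ((m.1 + 2).factorial / (c / 2) ^ (m.1 + 2) * Real.exp (c / 2))
        ≤ 4 ^ m.2 * coneCutoffBound S m.2 * (1 + ‖expForm z‖) ^ m.2 * Real.exp A *
          (κ ^ 2 * ‖w‖ ^ 2) * ((m.1 + 2).factorial / (c / 2) ^ (m.1 + 2) * Real.exp (c / 2)) := by
          gcongr
      _ = K m * ‖w‖ ^ 2 := by rw [hK]; ring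
  -- Step 6: the bound on `F(z+w) − F(z) − L w`
  set Ktot : ℝ := Cu * ∑ m ∈ Finset.Iic (k₀, n₀), K m with hKtot
  have hKtot0 : 0 ≤ Ktot := by rw [hKtot]; exact mul_nonneg hCu (Finset.sum_nonneg fun m _ => hK0 m)
  have hmain : ∀ w : ι → ℂ, ‖w‖ ≤ ρ' →
      ‖fourierLaplaceFun T S (z + w) - fourierLaplaceFun T S z - L w‖ ≤ Ktot * ‖w‖ ^ 2 := by
    intro w hw
    have hlin : fourierLaplaceFun T S (z + w) - fourierLaplaceFun T S z - L w =
        fourierInvDual T (laplaceKernel S (z + w) - laplaceKernel S z - ∑ i, w i • Ψ i) := by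
      rw [fourierLaplaceFun_apply, fourierLaplaceFun_apply, hL_apply, map_sub, map_sub]
    rw [hlin]
    refine (hu _).trans ?_
    rw [hKtot, mul_assoc]
    refine mul_le_mul_of_nonneg_left ?_ hCu
    refine Seminorm.finset_sup_apply_le
      (mul_nonneg (Finset.sum_nonneg fun m' _ => hK0 m') (by positivity)) fun m hm => ?_
    rw [schwartzSeminormFamily_apply]
    calc SchwartzMap.seminorm ℂ m.1 m.2 _ ≤ K m * ‖w‖ ^ 2 := hsemi w hw m
      _ ≤ (∑ m' ∈ Finset.Iic (k₀, n₀), K m') * ‖w‖ ^ 2 := by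
          gcongr
          exact Finset.single_le_sum (fun m' _ => hK0 m') hm
  -- Step 7: conclusion
  rw [hasFDerivAt_iff_isLittleO_nhds_zero, Asymptotics.isLittleO_iff]
  intro ε hε
  have hev : ∀ᶠ w : ι → ℂ in 𝓝 0, ‖w‖ ≤ min ρ' (ε / (Ktot + 1)) := by
    have hr : 0 < min ρ' (ε / (Ktot + 1)) := lt_min hρ'0 (div_pos hε (by linarith))
    have h := Metric.closedBall_mem_nhds (0 : ι → ℂ) hr
    filter_upwards [h] with w hw
    rw [mem_closedBall, dist_zero_right] at hw
    exact hw
  filter_upwards [hev] with w hw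
  have hw1 : ‖w‖ ≤ ρ' := hw.trans (min_le_left _ _)
  have hw2 : ‖w‖ ≤ ε / (Ktot + 1) := hw.trans (min_le_right _ _)
  calc ‖fourierLaplaceFun T S (z + w) - fourierLaplaceFun T S z - L w‖ ≤ Ktot * ‖w‖ ^ 2 :=
        hmain w hw1
    _ = (Ktot * ‖w‖) * ‖w‖ := by ring
    _ ≤ ε * ‖w‖ := by
        gcongr
        calc Ktot * ‖w‖ ≤ Ktot * (ε / (Ktot + 1)) := by gcongr
          _ ≤ ε := by
              rw [mul_div_assoc']
              rw [div_le_iff₀ (by positivity)]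
              nlinarith

/-- **The Fourier–Laplace transform is holomorphic in the tube `{Im z ∈ interior S⁻}`**
(Streater–Wightman (1964), Thm. 2-6; Hörmander (1990), Thm. 7.4.2).
[cite: StreaterWightman1964, Thm 2-6] -/
theorem differentiableOn_fourierLaplaceFun (T : 𝓢(EuclideanSpace ℝ ι, ℂ) →L[ℂ] ℂ)
    (S : Set (EuclideanSpace ℝ ι)) :
    DifferentiableOn ℂ (fourierLaplaceFun T S) {z | imVec z ∈ interior (polarCone S)} :=
  fun _ hz => (hasFDerivAt_fourierLaplaceFun T S hz).differentiableAt.differentiableWithinAt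

end Literature.Analysis.Distribution
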